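import Literature.Probability.Percolation.OrientedWalkMeeting
import Literature.Probability.Percolation.ShieldedPairWeights
import HarnessLib

/-!
# Returns of the difference chain to `0` and its visits to `S₂`: BDNS Lemma 4.1 (expectations)

Topic `Literature/Probability/Percolation`.  Sorry-free, no named facts.  Finite-horizon versions of
the expectation identities in the proof of Lemma 4.1 of Bock–Damron–Newman–Sidoravicius,
*Percolation of finite clusters and shielded paths*, J. Stat. Phys. 179 (2020), §4, for the
difference chain `D_k = S'_k - S_k` of two independent uniform oriented walks (`h_k = ‖D_k‖₁`):

* `iterAvg d f k z = E_z f(D_k)` (the `k`-fold averaging operator), its linearity and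
  translation invariance, and `E_z 1[D_k = 0] = diffProb d k (-z)` (`iterAvg_ind0`);
* the LAST-STEP identity (BDNS p. 9: `P(h_k = 0) = (1/d) P(h_{k-1} = 0) + (1/d²) P(h_{k-1} = 2)`):
  `sv k ≤ d² u_{k+1}(0) - d u_k(0)` for `u_k(0) = P_0(D_k = 0)`, `sv k = P_0(D_k ∈ S₂)`
  (`svis_le`, an inequality only because we do not prove that `S₂ = {e_c - e_c'}` is parametrised
  injectively);
* the first-return densities `fret d k z = P_z(first return to 0 at time k + 1)` and the renewal
  inequality `E_0 #Z_n ≤ P_0(τ ≤ n)(1 + E_0 #Z_n)` (`zsum_le_retProb_mul`), whence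
  **`zsum_le`**: `E_0 #{1 ≤ k ≤ n : D_k = 0} ≤ ρ/(1 - ρ)` whenever `P_0(τ ≤ n) ≤ ρ < 1` for all `n`
  (BDNS (4.5): `P(#Z ≥ k) = p_d^k`, `E#Z = p_d/(1 - p_d)`);
* **`osum_le`**: `E_0 #{1 ≤ k ≤ n : D_k ∈ S₂} ≤ (d² - d) ρ/(1 - ρ) - d = (d²ρ - d)/(1 - ρ)`
  (BDNS (4.4)–(4.6): `E#O = 1/(1 - p₂)` and `p₂ = t(p_d)`), via a small limiting argument
  (`P_0(D_k = 0)` is summable, hence small along a subsequence);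
* **`retProb_zero_le`**: `P_0(τ ≤ n) ≤ retHead d + retMid d + d Σ_{j ≤ n+1} balancedTerm d j`, the
  finite form of `p_d ≤ B(d)` (BDNS Lemma 4.1, item 2, with the successor counts `3d`, `d²` of
  `OrientedWalkSuccessors.lean` in place of `3d - 4`, `d² - 3d + 3`).

## References

* B. Bock, M. Damron, C. M. Newman, V. Sidoravicius, J. Stat. Phys. 179 (2020) 789–807,
  arXiv:1811.01678, §4, Lemma 4.1 and its proof, (4.4)–(4.9). [BockEtAl2020]
-/

noncomputable section

namespace Literature.Probability.Percolation

open Finset Literature.Probability.LatticeModels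
open scoped Nat

variable {d : ℕ}

/-! ### The averaging operator of the difference chain -/

/-- One step of the difference chain: `(T f)(z) = d^{-2} Σ_{a,a'} f(z + e_{a'} - e_a)`.
[cite: BockEtAl2020, §3 (the chain S_n - S'_n)] -/
def stepAvg (d : ℕ) (f : Site d → ℝ) (z : Site d) : ℝ :=
  ((d : ℝ) ^ 2)⁻¹ * ∑ a : Fin d, ∑ a' : Fin d, f (z + Pi.single a' 1 - Pi.single a 1)

/-- `iterAvg d f k z = E_z f(D_k)`. [cite: BockEtAl2020, §3 (the chain S_n - S'_n)] -/
def iterAvg (d : ℕ) (f : Site d → ℝ) : ℕ → Site d → ℝ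
  | 0 => f
  | k + 1 => stepAvg d (iterAvg d f k)

/-- Unfolding. [folklore] -/
@[simp] theorem iterAvg_zero (f : Site d → ℝ) : iterAvg d f 0 = f := rfl

/-- Unfolding (first-step form). [folklore] -/
theorem iterAvg_succ (f : Site d → ℝ) (k : ℕ) (z : Site d) :
    iterAvg d f (k + 1) z = ((d : ℝ) ^ 2)⁻¹ * ∑ a : Fin d, ∑ a' : Fin d,
      iterAvg d f k (z + Pi.single a' 1 - Pi.single a 1) := rfl

/-- Unfolding (last-step form): `E_z f(D_{k+1}) = E_z (T f)(D_k)`. [folklore] -/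
theorem iterAvg_succ' (f : Site d → ℝ) : ∀ (k : ℕ) (z : Site d),
    iterAvg d f (k + 1) z = iterAvg d (stepAvg d f) k z
  | 0, z => rfl
  | k + 1, z => by
    rw [iterAvg_succ, iterAvg_succ]
    congr 1
    refine Finset.sum_congr rfl fun a _ => Finset.sum_congr rfl fun a' _ => ?_
    exact iterAvg_succ' f k _

/-- Linearity: sums. [folklore] -/
theorem iterAvg_add (f g : Site d → ℝ) : ∀ (k : ℕ) (z : Site d),
    iterAvg d (fun y => f y + g y) k z = iterAvg d f k z + iterAvg d g k z
  | 0, z => rfl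
  | k + 1, z => by
    simp only [iterAvg_succ, iterAvg_add f g k, Finset.sum_add_distrib, mul_add]

/-- Linearity: scalars. [folklore] -/
theorem iterAvg_const_mul (c : ℝ) (f : Site d → ℝ) : ∀ (k : ℕ) (z : Site d),
    iterAvg d (fun y => c * f y) k z = c * iterAvg d f k z
  | 0, z => rfl
  | k + 1, z => by
    simp only [iterAvg_succ, iterAvg_const_mul c f k, ← Finset.mul_sum]
    ring

/-- Linearity: finite sums. [folklore] -/
theorem iterAvg_finset_sum {ι : Type*} (s : Finset ι) (f : ι → Site d → ℝ) (k : ℕ) (z : Site d) :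
    iterAvg d (fun y => ∑ i ∈ s, f i y) k z = ∑ i ∈ s, iterAvg d (f i) k z := by
  classical
  induction s using Finset.induction_on with
  | empty =>
    simp only [Finset.sum_empty]
    induction k generalizing z with
    | zero => rfl
    | succ k ih => simp [iterAvg_succ, ih]
  | insert i s hi ih =>
    simp only [Finset.sum_insert hi]
    rw [← ih, ← iterAvg_add]

/-- Monotonicity. [folklore] -/
theorem iterAvg_mono {f g : Site d → ℝ} (h : ∀ y, f y ≤ g y) : ∀ (k : ℕ) (z : Site d),
    iterAvg d f k z ≤ iterAvg d g k z
  | 0, z => h z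
  | k + 1, z => by
    rw [iterAvg_succ, iterAvg_succ]
    exact mul_le_mul_of_nonneg_left (Finset.sum_le_sum fun a _ => Finset.sum_le_sum fun a' _ =>
      iterAvg_mono h k _) (by positivity)

/-- Nonnegativity. [folklore] -/
theorem iterAvg_nonneg {f : Site d → ℝ} (h : ∀ y, 0 ≤ f y) : ∀ (k : ℕ) (z : Site d),
    0 ≤ iterAvg d f k z
  | 0, z => h z
  | k + 1, z => by
    rw [iterAvg_succ]
    exact mul_nonneg (by positivity) (Finset.sum_nonneg fun a _ => Finset.sum_nonneg fun a' _ =>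
      iterAvg_nonneg h k _)

/-- Translation invariance of the chain. [folklore] -/
theorem iterAvg_comp_sub (f : Site d → ℝ) (y : Site d) : ∀ (k : ℕ) (z : Site d),
    iterAvg d (fun x => f (x - y)) k z = iterAvg d f k (z - y)
  | 0, z => rfl
  | k + 1, z => by
    rw [iterAvg_succ, iterAvg_succ]
    congr 1
    refine Finset.sum_congr rfl fun a _ => Finset.sum_congr rfl fun a' _ => ?_
    rw [iterAvg_comp_sub f y k]
    congr 1
    abel

/-- The indicator of `0`. [folklore] -/
def ind0 (y : Site d) : ℝ := if y = 0 then 1 else 0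

/-- The indicator of `S₂`. [folklore] -/
def indS2 (y : Site d) : ℝ := if IsS2 y then 1 else 0

/-- **`E_z 1[D_k = 0] = diffProb d k (-z)`**: the averaging recursion reproduces the pair counts of
`OrientedWalkCounts.lean`. [cite: BockEtAl2020, §4] -/
theorem iterAvg_ind0 : ∀ (k : ℕ) (z : Site d), iterAvg d ind0 k z = diffProb d k (-z)
  | 0, z => by simp [ind0, diffProb_zero, neg_eq_zero]
  | k + 1, z => by
    rw [iterAvg_succ, diffProb_succ]
    congr 1
    refine Finset.sum_congr rfl fun a _ => Finset.sum_congr rfl fun a' _ => ?_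
    rw [iterAvg_ind0 k]
    congr 1
    abel

/-- At the origin: `E_0 1[D_k = 0] = diffProb d k 0`. [cite: BockEtAl2020, §4] -/
theorem iterAvg_ind0_zero (k : ℕ) : iterAvg d ind0 k (0 : Site d) = diffProb d k 0 := by
  rw [iterAvg_ind0, neg_zero]

/-- `E_z 1[D_k = 0] ≥ 0`. [folklore] -/
theorem iterAvg_ind0_nonneg (k : ℕ) (z : Site d) : 0 ≤ iterAvg d ind0 k z :=
  iterAvg_nonneg (fun y => by unfold ind0; split_ifs <;> norm_num) k z

/-! ### The last-step identity: visits to `S₂` in terms of visits to `0` -/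

/-- `P_0(D_k ∈ S₂) = E_0 1_{S₂}(D_k)`. [cite: BockEtAl2020, §4 (`#O_n`)] -/
def svis (d k : ℕ) : ℝ := iterAvg d indS2 k (0 : Site d)

/-- `1_{S₂} ≤ Σ_{c ≠ c'} 1_{\{e_{c'} - e_c\}}`. [folklore] -/
theorem indS2_le_sum (y : Site d) :
    indS2 y ≤ ∑ c : Fin d, ∑ c' : Fin d,
      (if c = c' then (0 : ℝ) else ind0 (y - (Pi.single c' 1 - Pi.single c 1))) := by
  have hnn : ∀ c c' : Fin d, (0 : ℝ) ≤
      (if c = c' then (0 : ℝ) else ind0 (y - (Pi.single c' 1 - Pi.single c 1))) := by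
    intro c c'
    split_ifs
    · exact le_rfl
    · unfold ind0; split_ifs <;> norm_num
  unfold indS2
  split_ifs with h
  · obtain ⟨i, j, hij, rfl⟩ := h
    calc (1 : ℝ) = (if j = i then (0 : ℝ) else
          ind0 ((Pi.single i 1 - Pi.single j 1 : Site d) - (Pi.single i 1 - Pi.single j 1))) := by
          rw [if_neg (Ne.symm hij), sub_self]
          simp [ind0]
      _ ≤ ∑ c' : Fin d, (if j = c' then (0 : ℝ) else
          ind0 ((Pi.single i 1 - Pi.single j 1 : Site d) - (Pi.single c' 1 - Pi.single j 1))) :=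
          Finset.single_le_sum (fun c' _ => hnn j c') (Finset.mem_univ i)
      _ ≤ _ := Finset.single_le_sum (fun c _ => Finset.sum_nonneg fun c' _ => hnn c c')
          (Finset.mem_univ j)
  · exact Finset.sum_nonneg fun c _ => Finset.sum_nonneg fun c' _ => hnn c c'

/-- `P_0(D_k ∈ S₂) ≤ Σ_{c ≠ c'} P_0(D_k = e_{c'} - e_c)`. [cite: BockEtAl2020, §4] -/
theorem svis_le_sum (k : ℕ) :
    svis d k ≤ ∑ c : Fin d, ∑ c' : Fin d,
      (if c = c' then (0 : ℝ) else diffProb d k (Pi.single c' 1 - Pi.single c 1)) := by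
  have h1 := iterAvg_mono (d := d) indS2_le_sum k 0
  refine (h1.trans_eq ?_)
  rw [iterAvg_finset_sum]
  refine Finset.sum_congr rfl fun c _ => ?_
  rw [iterAvg_finset_sum]
  refine Finset.sum_congr rfl fun c' _ => ?_
  split_ifs with h
  · -- the zero function
    clear h1
    induction k with
    | zero => rfl
    | succ k ih =>
      rw [iterAvg_succ']
      have : stepAvg d (fun _ : Site d => (0 : ℝ)) = fun _ => 0 := by
        funext z; simp [stepAvg]
      rw [this, ih]
  · rw [iterAvg_comp_sub ind0, iterAvg_ind0, zero_sub, neg_neg]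

/-- **The last-step identity** (BDNS p. 9, `P(h_k = 0) = (1/d)P(h_{k-1} = 0) + (1/d²)P(h_{k-1} = 2)`),
as an inequality: `P_0(D_k ∈ S₂) ≤ d² P_0(D_{k+1} = 0) - d P_0(D_k = 0)`.
[cite: BockEtAl2020, §4 (proof of Lemma 4.1, item 1)] -/
theorem svis_le (hd : 1 ≤ d) (k : ℕ) :
    svis d k ≤ (d : ℝ) ^ 2 * diffProb d (k + 1) 0 - d * diffProb d k 0 := by
  have hd0 : (d : ℝ) ≠ 0 := by exact_mod_cast (show d ≠ 0 by omega)
  -- `d² u_{k+1}(0) = Σ_{a,a'} u_k(e_{a'} - e_a)` (value convention) `= d u_k(0) + Σ_{a ≠ a'} …`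
  have hsucc : (d : ℝ) ^ 2 * diffProb d (k + 1) 0 =
      ∑ a : Fin d, ∑ a' : Fin d, diffProb d k (Pi.single a 1 - Pi.single a' 1) := by
    rw [diffProb_succ]
    simp only [zero_add]
    field_simp
  have hsplit : ∀ a a' : Fin d, diffProb d k (Pi.single a 1 - Pi.single a' 1) =
      (if a' = a then diffProb d k 0 else 0) +
        (if a' = a then (0 : ℝ) else diffProb d k (Pi.single a 1 - Pi.single a' 1)) := by
    intro a a'
    split_ifs with h
    · subst h; simp
    · simp
  rw [hsucc, Finset.sum_congr rfl fun a _ => Finset.sum_congr rfl fun a' _ => hsplit a a',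
    Finset.sum_comm]
  simp only [Finset.sum_add_distrib, Finset.sum_ite_eq, Finset.mem_univ, if_true, Finset.sum_const,
    Finset.card_univ, Fintype.card_fin, nsmul_eq_mul]
  have := svis_le_sum (d := d) k
  linarith

/-! ### First returns to `0` and the expected number of visits to `0` -/

/-- `fret d k z = P_z(the first visit of D to 0 during [1, ∞) is at time k + 1)`.
[cite: BockEtAl2020, §4 (the stopping time τ)] -/
def fret (d : ℕ) : ℕ → Site d → ℝ
  | 0, z => ((d : ℝ) ^ 2)⁻¹ * ∑ a : Fin d, ∑ a' : Fin d,
      if z + Pi.single a' 1 - Pi.single a 1 = 0 then 1 else 0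
  | k + 1, z => ((d : ℝ) ^ 2)⁻¹ * ∑ a : Fin d, ∑ a' : Fin d,
      if z + Pi.single a' 1 - Pi.single a 1 = 0 then 0 else fret d k (z + Pi.single a' 1 - Pi.single a 1)

/-- Unfolding. [folklore] -/
theorem fret_zero (z : Site d) : fret d 0 z = ((d : ℝ) ^ 2)⁻¹ * ∑ a : Fin d, ∑ a' : Fin d,
    if z + Pi.single a' 1 - Pi.single a 1 = 0 then (1 : ℝ) else 0 := rfl

/-- Unfolding. [folklore] -/
theorem fret_succ (k : ℕ) (z : Site d) : fret d (k + 1) z = ((d : ℝ) ^ 2)⁻¹ * ∑ a : Fin d, ∑ a' : Fin d,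
    if z + Pi.single a' 1 - Pi.single a 1 = 0 then (0 : ℝ)
      else fret d k (z + Pi.single a' 1 - Pi.single a 1) := rfl

/-- `fret ≥ 0`. [folklore] -/
theorem fret_nonneg : ∀ (k : ℕ) (z : Site d), 0 ≤ fret d k z
  | 0, z => by
    rw [fret_zero]
    exact mul_nonneg (by positivity) (Finset.sum_nonneg fun a _ => Finset.sum_nonneg fun a' _ => by
      split_ifs <;> norm_num)
  | k + 1, z => by
    rw [fret_succ]
    refine mul_nonneg (by positivity) (Finset.sum_nonneg fun a _ => Finset.sum_nonneg fun a' _ => ?_)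
    split_ifs
    · exact le_rfl
    · exact fret_nonneg k _

/-- `P_z(first return at k+1) ≤ P_z(D_{k+1} = 0)`. [cite: BockEtAl2020, §4 (`P(τ = k) ≤ P(S_k = S'_k)`)] -/
theorem fret_le : ∀ (k : ℕ) (z : Site d), fret d k z ≤ iterAvg d ind0 (k + 1) z
  | 0, z => by
    rw [fret_zero, iterAvg_succ]
    refine mul_le_mul_of_nonneg_left (Finset.sum_le_sum fun a _ => Finset.sum_le_sum fun a' _ => ?_)
      (by positivity)
    simp [ind0]
  | k + 1, z => by
    rw [fret_succ, iterAvg_succ]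
    refine mul_le_mul_of_nonneg_left (Finset.sum_le_sum fun a _ => Finset.sum_le_sum fun a' _ => ?_)
      (by positivity)
    split_ifs
    · exact iterAvg_ind0_nonneg _ _
    · exact fret_le k _

/-- `P_z(τ ≤ n) = Σ_{k<n} fret d k z`. [cite: BockEtAl2020, §4 (`p_d = P(τ < ∞)`)] -/
def retProb (d n : ℕ) (z : Site d) : ℝ := ∑ k ∈ range n, fret d k z

/-- `E_z #{1 ≤ k ≤ n : D_k = 0}`. [cite: BockEtAl2020, §4 (`E #Z_n`)] -/
def zsum (d n : ℕ) (z : Site d) : ℝ := ∑ k ∈ range n, iterAvg d ind0 (k + 1) z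

/-- `zsum ≥ 0`. [folklore] -/
theorem zsum_nonneg (n : ℕ) (z : Site d) : 0 ≤ zsum d n z :=
  Finset.sum_nonneg fun _ _ => iterAvg_ind0_nonneg _ _

/-- `zsum` is non-decreasing in `n`. [folklore] -/
theorem zsum_mono (z : Site d) : Monotone fun n => zsum d n z := by
  refine monotone_nat_of_le_succ fun n => ?_
  simp only [zsum, Finset.sum_range_succ]
  exact le_add_of_nonneg_right (iterAvg_ind0_nonneg _ _)

/-- First-step recursion of `zsum`. [folklore] -/
theorem zsum_succ (n : ℕ) (z : Site d) :
    zsum d (n + 1) z = ((d : ℝ) ^ 2)⁻¹ * ∑ a : Fin d, ∑ a' : Fin d,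
      (ind0 (z + Pi.single a' 1 - Pi.single a 1) + zsum d n (z + Pi.single a' 1 - Pi.single a 1)) := by
  rw [zsum, Finset.sum_range_succ', Finset.sum_congr rfl fun k _ => iterAvg_succ ind0 (k + 1) z,
    iterAvg_succ ind0 0 z]
  simp only [iterAvg_zero]
  rw [← Finset.mul_sum, ← mul_add]
  congr 1
  rw [Finset.sum_comm, ← Finset.sum_add_distrib]
  refine Finset.sum_congr rfl fun a _ => ?_
  rw [Finset.sum_comm, ← Finset.sum_add_distrib]
  refine Finset.sum_congr rfl fun a' _ => ?_
  rw [zsum, add_comm]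

/-- Indicator values. [folklore] -/
@[simp] theorem ind0_zero : ind0 (0 : Site d) = 1 := if_pos rfl

/-- Indicator values. [folklore] -/
theorem ind0_of_ne {y : Site d} (h : y ≠ 0) : ind0 y = 0 := if_neg h

/-- Summing an average over time is the average of the sum. [folklore] -/
theorem sum_range_avg (n : ℕ) (F : ℕ → Fin d → Fin d → ℝ) :
    ∑ k ∈ range n, (((d : ℝ) ^ 2)⁻¹ * ∑ a : Fin d, ∑ a' : Fin d, F k a a') =
      ((d : ℝ) ^ 2)⁻¹ * ∑ a : Fin d, ∑ a' : Fin d, ∑ k ∈ range n, F k a a' := by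
  rw [← Finset.mul_sum]
  congr 1
  exact (sum_sum_sum_comm _ _ _ _).symm

/-- **Renewal inequality for the expected number of zeros**:
`E_z #Z_n ≤ Σ_{k<n} P_z(τ = k+1)(1 + E_0 #Z_{n-k-1})`. [cite: BockEtAl2020, §4 (4.5)] -/
theorem zsum_le_sum_fret : ∀ (n : ℕ) (z : Site d),
    zsum d n z ≤ ∑ k ∈ range n, fret d k z * (1 + zsum d (n - (k + 1)) 0)
  | 0, z => by simp [zsum]
  | n + 1, z => by
    rw [zsum_succ, Finset.sum_range_succ']
    simp only [Nat.add_sub_add_right, Nat.sub_zero]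
    have e1 : ∀ k : ℕ, fret d (k + 1) z * (1 + zsum d (n - (k + 1)) 0) =
        ((d : ℝ) ^ 2)⁻¹ * ∑ a : Fin d, ∑ a' : Fin d,
          ((if z + Pi.single a' 1 - Pi.single a 1 = 0 then (0 : ℝ)
            else fret d k (z + Pi.single a' 1 - Pi.single a 1)) * (1 + zsum d (n - (k + 1)) 0)) := by
      intro k
      rw [fret_succ, mul_assoc, Finset.sum_mul]
      congr 1
      exact Finset.sum_congr rfl fun a _ => Finset.sum_mul _ _ _
    have e2 : fret d 0 z * (1 + zsum d n 0) =
        ((d : ℝ) ^ 2)⁻¹ * ∑ a : Fin d, ∑ a' : Fin d,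
          ((if z + Pi.single a' 1 - Pi.single a 1 = 0 then (1 : ℝ) else 0) * (1 + zsum d n 0)) := by
      rw [fret_zero, mul_assoc, Finset.sum_mul]
      congr 1
      exact Finset.sum_congr rfl fun a _ => Finset.sum_mul _ _ _
    rw [Finset.sum_congr rfl fun k _ => e1 k, e2, sum_range_avg, ← mul_add, ← Finset.sum_add_distrib]
    refine mul_le_mul_of_nonneg_left (Finset.sum_le_sum fun a _ => ?_) (by positivity)
    rw [← Finset.sum_add_distrib]
    refine Finset.sum_le_sum fun a' _ => ?_
    by_cases hy0 : z + Pi.single a' 1 - Pi.single a 1 = 0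
    · simp only [hy0, if_true, zero_mul, Finset.sum_const_zero, zero_add, one_mul, ind0_zero]
      exact le_rfl
    · rw [ind0_of_ne hy0, zero_add, if_neg hy0, zero_mul, add_zero]
      simp only [if_neg hy0]
      exact zsum_le_sum_fret n _

/-- `E_0 #Z_n ≤ P_0(τ ≤ n)(1 + E_0 #Z_n)`. [cite: BockEtAl2020, §4 (4.5)] -/
theorem zsum_le_retProb_mul (n : ℕ) :
    zsum d n (0 : Site d) ≤ retProb d n 0 * (1 + zsum d n 0) := by
  calc zsum d n (0 : Site d) ≤ ∑ k ∈ range n, fret d k 0 * (1 + zsum d (n - (k + 1)) 0) :=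
        zsum_le_sum_fret n 0
    _ ≤ ∑ k ∈ range n, fret d k 0 * (1 + zsum d n 0) := by
        refine Finset.sum_le_sum fun k _ => mul_le_mul_of_nonneg_left ?_ (fret_nonneg k 0)
        have h := zsum_mono (d := d) 0 (Nat.sub_le n (k + 1))
        simp only at h
        linarith
    _ = retProb d n 0 * (1 + zsum d n 0) := by rw [retProb, Finset.sum_mul]

/-- **BDNS (4.5), finite form**: if `P_0(τ ≤ n) ≤ ρ < 1` for all `n` then `E_0 #Z_n ≤ ρ/(1 - ρ)`.
[cite: BockEtAl2020, §4 (4.5)] -/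
theorem zsum_le {ρ : ℝ} (hρ : ∀ n, retProb d n (0 : Site d) ≤ ρ) (hρ1 : ρ < 1) (n : ℕ) :
    zsum d n (0 : Site d) ≤ ρ / (1 - ρ) := by
  have h := zsum_le_retProb_mul (d := d) n
  have hz := zsum_nonneg (d := d) n 0
  have h2 : zsum d n (0 : Site d) ≤ ρ * (1 + zsum d n 0) :=
    h.trans (mul_le_mul_of_nonneg_right (hρ n) (by linarith))
  rw [le_div_iff₀ (sub_pos.2 hρ1)]
  nlinarith

/-! ### The expected number of visits to `S₂` -/

/-- `E_0 #{1 ≤ k ≤ n : D_k ∈ S₂}`. [cite: BockEtAl2020, §4 (`E #O_n`)] -/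
def osum (d n : ℕ) : ℝ := ∑ k ∈ range n, svis d (k + 1)

/-- `svis ≥ 0`. [folklore] -/
theorem svis_nonneg (k : ℕ) : 0 ≤ svis d k :=
  iterAvg_nonneg (fun y => by unfold indS2; split_ifs <;> norm_num) k 0

/-- `osum` is non-decreasing. [folklore] -/
theorem osum_mono : Monotone (osum d) := by
  refine monotone_nat_of_le_succ fun n => ?_
  simp only [osum, Finset.sum_range_succ]
  exact le_add_of_nonneg_right (svis_nonneg _)

/-- Summing the last-step identity (`P_0(D_1 = 0) = 1/d`):
`E_0 #O_n ≤ (d² - d) E_0 #Z_{n+1} - d + d P_0(D_{n+1} = 0)`. [cite: BockEtAl2020, §4 (4.4)] -/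
theorem osum_le_aux (hd : 1 ≤ d) (n : ℕ) :
    osum d n ≤ ((d : ℝ) ^ 2 - d) * zsum d (n + 1) 0 - d + d * diffProb d (n + 1) 0 := by
  have hd0 : (d : ℝ) ≠ 0 := by exact_mod_cast (show d ≠ 0 by omega)
  have h1 : osum d n ≤ ∑ k ∈ range n,
      ((d : ℝ) ^ 2 * diffProb d (k + 1 + 1) 0 - d * diffProb d (k + 1) 0) :=
    Finset.sum_le_sum fun k _ => svis_le hd (k + 1)
  have hz : zsum d (n + 1) (0 : Site d) = ∑ k ∈ range (n + 1), diffProb d (k + 1) 0 :=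
    Finset.sum_congr rfl fun k _ => iterAvg_ind0_zero (k + 1)
  have hu1 : diffProb d 1 (0 : Site d) = 1 / d := by
    rw [diffProb_succ]
    simp only [zero_add, diffProb_zero, single_sub_single_eq_zero_iff]
    rw [show ∑ a : Fin d, ∑ a' : Fin d, (if a = a' then (1 : ℝ) else 0) = d from sum_sum_boole_eq d]
    field_simp
  have e1 : ∑ k ∈ range n, diffProb d (k + 1 + 1) (0 : Site d) = zsum d (n + 1) 0 - 1 / d := by
    rw [hz, Finset.sum_range_succ' (fun k => diffProb d (k + 1) (0 : Site d)), hu1]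
    ring
  have e2 : ∑ k ∈ range n, diffProb d (k + 1) (0 : Site d) = zsum d (n + 1) 0 - diffProb d (n + 1) 0 := by
    rw [hz, Finset.sum_range_succ]
    ring
  rw [Finset.sum_sub_distrib, ← Finset.mul_sum, ← Finset.mul_sum, e1, e2] at h1
  have e3 : (d : ℝ) ^ 2 * (1 / d) = d := by field_simp
  nlinarith [h1, e3]

/-- The zeros are summable, so `P_0(D_k = 0)` is small along a subsequence: for every `ε > 0` and
`n` there is `m ≥ n` with `P_0(D_{m+1} = 0) < ε`. [folklore] -/
theorem exists_diffProb_lt {Z : ℝ} (hZ : ∀ n, zsum d n (0 : Site d) ≤ Z) {ε : ℝ} (hε : 0 < ε) (n : ℕ) :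
    ∃ m, n ≤ m ∧ diffProb d (m + 1) (0 : Site d) < ε := by
  by_contra hcon
  push Not at hcon
  -- all `P_0(D_{m+1} = 0) ≥ ε` for `m ≥ n`: the partial sums grow linearly
  obtain ⟨M, hM⟩ := exists_nat_gt (Z / ε)
  have hz : zsum d (n + M) (0 : Site d) = ∑ k ∈ range (n + M), diffProb d (k + 1) 0 :=
    Finset.sum_congr rfl fun k _ => iterAvg_ind0_zero (k + 1)
  have hsum : (M : ℝ) * ε ≤ zsum d (n + M) 0 := by
    rw [hz]
    calc (M : ℝ) * ε = ∑ _k ∈ Ico n (n + M), ε := by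
          rw [Finset.sum_const, Nat.card_Ico, nsmul_eq_mul]
          congr 1
          have : n + M - n = M := by omega
          rw [this]
      _ ≤ ∑ k ∈ Ico n (n + M), diffProb d (k + 1) (0 : Site d) :=
          Finset.sum_le_sum fun k hk => hcon k (Finset.mem_Ico.1 hk).1
      _ ≤ ∑ k ∈ range (n + M), diffProb d (k + 1) (0 : Site d) :=
          Finset.sum_le_sum_of_subset_of_nonneg (fun k hk => by
            rw [Finset.mem_Ico] at hk; rw [Finset.mem_range]; omega)
            fun k _ _ => diffProb_nonneg _ _ _
  have h2 := hZ (n + M)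
  have h3 : Z < M * ε := by rwa [div_lt_iff₀ hε] at hM
  linarith

/-- **BDNS (4.4)–(4.6), finite form: `E_0 #O_n ≤ (d²ρ - d)/(1 - ρ)`** whenever `P_0(τ ≤ n) ≤ ρ < 1`
for all `n` (the value `1/(1 - t(ρ))`, `t(x) = ((d²+1)x - d - 1)/(d²x - d)`, of Lemma 4.1 item 1).
[cite: BockEtAl2020, §4 Lemma 4.1 (item 1), (4.4)–(4.6)] -/
theorem osum_le (hd : 1 ≤ d) {ρ : ℝ} (hρ : ∀ n, retProb d n (0 : Site d) ≤ ρ) (hρ1 : ρ < 1) (n : ℕ) :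
    osum d n ≤ ((d : ℝ) ^ 2 - d) * (ρ / (1 - ρ)) - d := by
  have hdpos : (0 : ℝ) < d := by exact_mod_cast hd
  have hd1 : (1 : ℝ) ≤ d := by exact_mod_cast hd
  have hdd : (0 : ℝ) ≤ (d : ℝ) ^ 2 - d := by nlinarith
  refine le_of_forall_pos_lt_add fun ε hε => ?_
  obtain ⟨m, hnm, hm⟩ := exists_diffProb_lt (zsum_le hρ hρ1) (div_pos hε hdpos) n
  calc osum d n ≤ osum d m := osum_mono hnm
    _ ≤ ((d : ℝ) ^ 2 - d) * zsum d (m + 1) 0 - d + d * diffProb d (m + 1) 0 := osum_le_aux hd m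
    _ < ((d : ℝ) ^ 2 - d) * (ρ / (1 - ρ)) - d + ε := by
        have h1 := mul_le_mul_of_nonneg_left (zsum_le hρ hρ1 (m + 1)) hdd
        have h2 : (d : ℝ) * diffProb d (m + 1) 0 < ε := by
          have := mul_lt_mul_of_pos_left hm hdpos
          rwa [mul_div_cancel₀ _ hdpos.ne'] at this
        linarith

/-! ### The explicit bound `p_d ≤ B(d)` (BDNS Lemma 4.1, item 2), finite form -/

/-- Subadditivity of sums of nonnegative terms over a union. [folklore] -/
private theorem sum_union_le_of_nonneg {ι : Type*} [DecidableEq ι] {s t : Finset ι} {f : ι → ℝ}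
    (hf : ∀ i, 0 ≤ f i) : ∑ i ∈ s ∪ t, f i ≤ ∑ i ∈ s, f i + ∑ i ∈ t, f i := by
  rw [← Finset.sum_union_inter]
  exact le_add_of_nonneg_right (Finset.sum_nonneg fun i _ => hf i)

/-- `fret d 0 y ≤ (1/d²)·1[y ∈ S₂] + (1/d)·1[y = 0]`; in particular `fret d 0 y = 0` far away.
[cite: BockEtAl2020, §4 (4.7)] -/
theorem fret_zero_le (hd : 1 ≤ d) (y : Site d) :
    fret d 0 y ≤ (if IsS2 y then 1 / (d : ℝ) ^ 2 else 0) + (if y = 0 then 1 / (d : ℝ) else 0) := by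
  have hd0 : (0 : ℝ) < d := by exact_mod_cast hd
  rw [fret_zero]
  by_cases hy0 : y = 0
  · subst hy0
    have : ¬ IsS2 (0 : Site d) := fun h => h.ne_zero rfl
    rw [if_neg this, if_pos rfl, zero_add]
    simp only [zero_add, single_sub_single_eq_zero_iff]
    rw [show ∑ a : Fin d, ∑ a' : Fin d, (if a' = a then (1 : ℝ) else 0) = d by
      simp [Finset.sum_ite_eq']]
    field_simp
    exact le_rfl
  · rw [if_neg hy0, add_zero]
    by_cases hyS : IsS2 y
    · rw [if_pos hyS]
      obtain ⟨i, j, hij, rfl⟩ := hyS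
      calc ((d : ℝ) ^ 2)⁻¹ * ∑ a : Fin d, ∑ a' : Fin d,
            (if Pi.single i 1 - Pi.single j 1 + Pi.single a' 1 - Pi.single a 1 = (0 : Site d)
              then (1 : ℝ) else 0)
          ≤ ((d : ℝ) ^ 2)⁻¹ * 1 := by
            refine mul_le_mul_of_nonneg_left ?_ (by positivity)
            rw [Finset.sum_comm]
            calc ∑ a' : Fin d, ∑ a : Fin d,
                  (if Pi.single i 1 - Pi.single j 1 + Pi.single a' 1 - Pi.single a 1 = (0 : Site d)
                    then (1 : ℝ) else 0)
                = ∑ a' : Fin d, ∑ a : Fin d, (if a' = j ∧ a = i then (1 : ℝ) else 0) := by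
                  refine Finset.sum_congr rfl fun a' _ => Finset.sum_congr rfl fun a _ => ?_
                  simp only [succ_S2_eq_zero_iff hij a' a]
              _ ≤ 1 := sum_sum_boole_pair_le j i
        _ = 1 / (d : ℝ) ^ 2 := by rw [mul_one, one_div]
    · rw [if_neg hyS]
      refine le_of_eq (mul_eq_zero_of_right _ (Finset.sum_eq_zero fun a _ =>
        Finset.sum_eq_zero fun a' _ => ?_))
      rw [if_neg (step_ne_zero_of_far hy0 hyS a a')]

/-- `fret d 1 y ≤ 3/d³` on `S₂`. [cite: BockEtAl2020, §4 (4.7)] -/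
theorem fret_one_le_of_isS2 (hd : 1 ≤ d) {y : Site d} (hy : IsS2 y) : fret d 1 y ≤ 3 / (d : ℝ) ^ 3 := by
  have hd0 : (0 : ℝ) < d := by exact_mod_cast hd
  obtain ⟨i, j, hij, rfl⟩ := hy
  rw [fret_succ]
  have hterm : ∀ a a' : Fin d,
      (if Pi.single i 1 - Pi.single j 1 + Pi.single a' 1 - Pi.single a 1 = (0 : Site d) then (0 : ℝ)
        else fret d 0 (Pi.single i 1 - Pi.single j 1 + Pi.single a' 1 - Pi.single a 1)) ≤
        (if a' = a ∨ a' = j ∨ a = i then (1 : ℝ) else 0) * (1 / (d : ℝ) ^ 2) := by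
    intro a a'
    by_cases h1 : Pi.single i 1 - Pi.single j 1 + Pi.single a' 1 - Pi.single a 1 = (0 : Site d)
    · rw [if_pos h1]
      exact mul_nonneg (by split_ifs <;> norm_num) (by positivity)
    · rw [if_neg h1]
      by_cases hC : a' = a ∨ a' = j ∨ a = i
      · rw [if_pos hC, one_mul]
        refine (fret_zero_le hd _).trans ?_
        rw [if_neg h1, add_zero]
        split_ifs
        · exact le_rfl
        · positivity
      · rw [if_neg hC, zero_mul]
        push Not at hC
        refine (fret_zero_le hd _).trans (le_of_eq ?_)
        rw [if_neg h1, if_neg (succ_far_not_isS2 hij hC.1 hC.2.1 hC.2.2), add_zero]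
  calc ((d : ℝ) ^ 2)⁻¹ * ∑ a : Fin d, ∑ a' : Fin d, _
      ≤ ((d : ℝ) ^ 2)⁻¹ * ∑ a : Fin d, ∑ a' : Fin d,
          (if a' = a ∨ a' = j ∨ a = i then (1 : ℝ) else 0) * (1 / (d : ℝ) ^ 2) :=
        mul_le_mul_of_nonneg_left
          (Finset.sum_le_sum fun a _ => Finset.sum_le_sum fun a' _ => hterm a a') (by positivity)
    _ = ((d : ℝ) ^ 2)⁻¹ * ((∑ a' : Fin d, ∑ a : Fin d,
          (if a' = a ∨ a' = j ∨ a = i then (1 : ℝ) else 0)) * (1 / (d : ℝ) ^ 2)) := by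
        rw [Finset.sum_comm, Finset.sum_mul]
        congr 1
        exact Finset.sum_congr rfl fun a' _ => (Finset.sum_mul _ _ _).symm
    _ ≤ ((d : ℝ) ^ 2)⁻¹ * ((3 * d) * (1 / (d : ℝ) ^ 2)) := by
        gcongr
        exact sum_sum_boole_succ_S2_le i j
    _ = 3 / (d : ℝ) ^ 3 := by field_simp

/-- `fret d 1 y ≤ 4/d⁴` from a far successor of an `S₂` state. [cite: BockEtAl2020, §4 (case (C))] -/
theorem fret_one_far_le (hd : 1 ≤ d) {i j a a' : Fin d} (hij : i ≠ j) (haa : a ≠ a') (haj : a ≠ j)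
    (hai : a' ≠ i) :
    fret d 1 (Pi.single i 1 - Pi.single j 1 + Pi.single a 1 - Pi.single a' 1) ≤ 4 / (d : ℝ) ^ 4 := by
  have hd0 : (0 : ℝ) < d := by exact_mod_cast hd
  rw [fret_succ]
  have hterm : ∀ b b' : Fin d,
      (if Pi.single i 1 - Pi.single j 1 + Pi.single a 1 - Pi.single a' 1 + Pi.single b' 1 -
          Pi.single b 1 = (0 : Site d) then (0 : ℝ)
        else fret d 0 (Pi.single i 1 - Pi.single j 1 + Pi.single a 1 - Pi.single a' 1 +
          Pi.single b' 1 - Pi.single b 1)) ≤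
        (if (b = i ∨ b = a) ∧ (b' = j ∨ b' = a') then (1 : ℝ) else 0) * (1 / (d : ℝ) ^ 2) := by
    intro b b'
    have hne := succ_far_step_ne_zero hij haa haj hai b' b
    rw [if_neg hne]
    refine (fret_zero_le hd _).trans ?_
    rw [if_neg hne, add_zero]
    by_cases h1 : IsS2 (Pi.single i (1 : ℤ) - Pi.single j 1 + Pi.single a 1 - Pi.single a' 1 +
        Pi.single b' 1 - Pi.single b 1)
    · rw [if_pos h1, if_pos (succ_far_S2 hij haa haj hai h1), one_mul]
    · rw [if_neg h1]
      exact mul_nonneg (by split_ifs <;> norm_num) (by positivity)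
  calc ((d : ℝ) ^ 2)⁻¹ * ∑ b : Fin d, ∑ b' : Fin d, _
      ≤ ((d : ℝ) ^ 2)⁻¹ * ∑ b : Fin d, ∑ b' : Fin d,
          (if (b = i ∨ b = a) ∧ (b' = j ∨ b' = a') then (1 : ℝ) else 0) * (1 / (d : ℝ) ^ 2) :=
        mul_le_mul_of_nonneg_left
          (Finset.sum_le_sum fun b _ => Finset.sum_le_sum fun b' _ => hterm b b') (by positivity)
    _ = ((d : ℝ) ^ 2)⁻¹ * ((∑ b' : Fin d, ∑ b : Fin d,
          (if (b = i ∨ b = a) ∧ (b' = j ∨ b' = a') then (1 : ℝ) else 0)) * (1 / (d : ℝ) ^ 2)) := by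
        rw [Finset.sum_comm, Finset.sum_mul]
        congr 1
        exact Finset.sum_congr rfl fun b' _ => (Finset.sum_mul _ _ _).symm
    _ ≤ ((d : ℝ) ^ 2)⁻¹ * (4 * (1 / (d : ℝ) ^ 2)) := by
        gcongr
        exact sum_sum_boole_far_le i a j a'
    _ = 4 / (d : ℝ) ^ 4 := by field_simp

/-- `fret d 2 y ≤ 13/d⁴` on `S₂`. [cite: BockEtAl2020, §4 (4.7), cases (A)–(C)] -/
theorem fret_two_le_of_isS2 (hd : 1 ≤ d) {y : Site d} (hy : IsS2 y) : fret d 2 y ≤ 13 / (d : ℝ) ^ 4 := by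
  have hd0 : (0 : ℝ) < d := by exact_mod_cast hd
  obtain ⟨i, j, hij, rfl⟩ := hy
  rw [fret_succ]
  have hterm : ∀ a a' : Fin d,
      (if Pi.single i 1 - Pi.single j 1 + Pi.single a' 1 - Pi.single a 1 = (0 : Site d) then (0 : ℝ)
        else fret d 1 (Pi.single i 1 - Pi.single j 1 + Pi.single a' 1 - Pi.single a 1)) ≤
        (if a' = a ∨ a' = j ∨ a = i then (1 : ℝ) else 0) * (3 / (d : ℝ) ^ 3) + 4 / (d : ℝ) ^ 4 := by
    intro a a'
    have h4 : (0 : ℝ) ≤ 4 / (d : ℝ) ^ 4 := by positivity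
    by_cases h1 : Pi.single i 1 - Pi.single j 1 + Pi.single a' 1 - Pi.single a 1 = (0 : Site d)
    · rw [if_pos h1]
      positivity
    · rw [if_neg h1]
      by_cases hC : a' = a ∨ a' = j ∨ a = i
      · have hS : IsS2 (Pi.single i (1 : ℤ) - Pi.single j 1 + Pi.single a' 1 - Pi.single a 1) := by
          rcases hC with rfl | rfl | rfl
          · rw [add_sub_cancel_right]
            exact isS2_single_sub_single hij
          · have h0 := succ_S2_eq_zero_iff hij a' a
            have hne : i ≠ a := fun h => h1 (h0.2 ⟨rfl, h.symm⟩)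
            exact ⟨i, a, hne, by abel⟩
          · have h0 := succ_S2_eq_zero_iff hij a' a
            have hne : a' ≠ j := fun h => h1 (h0.2 ⟨h, rfl⟩)
            exact ⟨a', j, hne, by abel⟩
        rw [if_pos hC, one_mul]
        linarith [fret_one_le_of_isS2 hd hS]
      · rw [if_neg hC, zero_mul, zero_add]
        push Not at hC
        exact fret_one_far_le hd hij hC.1 hC.2.1 hC.2.2
  calc ((d : ℝ) ^ 2)⁻¹ * ∑ a : Fin d, ∑ a' : Fin d, _
      ≤ ((d : ℝ) ^ 2)⁻¹ * ∑ a : Fin d, ∑ a' : Fin d,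
          ((if a' = a ∨ a' = j ∨ a = i then (1 : ℝ) else 0) * (3 / (d : ℝ) ^ 3) + 4 / (d : ℝ) ^ 4) :=
        mul_le_mul_of_nonneg_left
          (Finset.sum_le_sum fun a _ => Finset.sum_le_sum fun a' _ => hterm a a') (by positivity)
    _ = ((d : ℝ) ^ 2)⁻¹ * ((∑ a' : Fin d, ∑ a : Fin d,
          (if a' = a ∨ a' = j ∨ a = i then (1 : ℝ) else 0)) * (3 / (d : ℝ) ^ 3) +
            (d : ℝ) ^ 2 * (4 / (d : ℝ) ^ 4)) := by
        rw [Finset.sum_comm]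
        simp only [Finset.sum_add_distrib, Finset.sum_mul, Finset.sum_const, Finset.card_univ,
          Fintype.card_fin, nsmul_eq_mul]
        ring
    _ ≤ ((d : ℝ) ^ 2)⁻¹ * ((3 * d) * (3 / (d : ℝ) ^ 3) + (d : ℝ) ^ 2 * (4 / (d : ℝ) ^ 4)) := by
        gcongr
        exact sum_sum_boole_succ_S2_le i j
    _ = 13 / (d : ℝ) ^ 4 := by
        field_simp
        ring

/-- The values at the origin: `fret d (k+1) 0 ≤ (1 - 1/d) · max_{S₂} fret d k`. [cite: BockEtAl2020, §4 (4.7)] -/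
theorem fret_succ_zero_le (hd : 1 ≤ d) (k : ℕ) {C : ℝ} (hC : ∀ y : Site d, IsS2 y → fret d k y ≤ C) :
    fret d (k + 1) (0 : Site d) ≤ (1 - 1 / (d : ℝ)) * C := by
  have hd0 : (0 : ℝ) < d := by exact_mod_cast hd
  rw [fret_succ]
  calc ((d : ℝ) ^ 2)⁻¹ * ∑ a : Fin d, ∑ a' : Fin d,
        (if (0 : Site d) + Pi.single a' 1 - Pi.single a 1 = 0 then (0 : ℝ)
          else fret d k ((0 : Site d) + Pi.single a' 1 - Pi.single a 1))
      ≤ ((d : ℝ) ^ 2)⁻¹ * ∑ a : Fin d, ∑ a' : Fin d, (if a = a' then (0 : ℝ) else C) := by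
        refine mul_le_mul_of_nonneg_left (Finset.sum_le_sum fun a _ => Finset.sum_le_sum fun a' _ => ?_)
          (by positivity)
        rw [zero_add]
        by_cases h : a = a'
        · subst h
          rw [sub_self, if_pos rfl, if_pos rfl]
        · rw [if_neg (fun h' => h (single_sub_single_eq_zero_iff.1 h').symm), if_neg h]
          exact hC _ (isS2_single_sub_single (Ne.symm h))
    _ = (1 - 1 / (d : ℝ)) * C := by
        rw [sum_sum_ite_ne_const]
        field_simp

/-- The head `P(τ ≤ 4) ≤ 1/d + (1 - 1/d)/d² + 3(1 - 1/d)/d³ + 13(1 - 1/d)/d⁴` of `B(d)` (BDNS (4.7) and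
the bounds for `P(τ = 3)`, `P(τ = 4)` with `3d`, `d²` for `3d - 4`, `d² - 3d + 3`).
[cite: BockEtAl2020, §4 Lemma 4.1 (item 2)] -/
def retHead (d : ℕ) : ℝ :=
  1 / d + (1 - 1 / (d : ℝ)) / (d : ℝ) ^ 2 + 3 * (1 - 1 / (d : ℝ)) / (d : ℝ) ^ 3 +
    13 * (1 - 1 / (d : ℝ)) / (d : ℝ) ^ 4

/-- The middle part `Σ_{k=5}^{d} k!/d^k` of `B(d)`. [cite: BockEtAl2020, §4 Lemma 4.1 (item 2)] -/
def retMid (d : ℕ) : ℝ := ∑ k ∈ Ico 5 (d + 1), (k ! : ℝ) / (d : ℝ) ^ k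

/-- `retMid ≥ 0`. [folklore] -/
theorem retMid_nonneg (d : ℕ) : 0 ≤ retMid d := Finset.sum_nonneg fun k _ => by positivity

/-- `retHead ≥ 0` for `d ≥ 1`. [folklore] -/
theorem retHead_nonneg (hd : 1 ≤ d) : 0 ≤ retHead d := by
  have hd0 : (0 : ℝ) < d := by exact_mod_cast hd
  have h1 : (0 : ℝ) ≤ 1 - 1 / (d : ℝ) := by
    rw [sub_nonneg, div_le_one hd0]; exact_mod_cast hd
  unfold retHead
  positivity

/-- `P_0(τ ≤ 4) ≤ retHead d`. [cite: BockEtAl2020, §4 Lemma 4.1 (item 2), (4.7)] -/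
theorem sum_fret_head_le (hd : 1 ≤ d) : ∑ k ∈ range 4, fret d k (0 : Site d) ≤ retHead d := by
  have hd0 : (0 : ℝ) < d := by exact_mod_cast hd
  have h0 : fret d 0 (0 : Site d) ≤ 1 / d := by
    refine (fret_zero_le hd 0).trans ?_
    rw [if_neg (fun h => IsS2.ne_zero h rfl), if_pos rfl, zero_add]
  have h1 : fret d 1 (0 : Site d) ≤ (1 - 1 / (d : ℝ)) * (1 / (d : ℝ) ^ 2) := by
    refine fret_succ_zero_le hd 0 fun y hy => ?_
    refine (fret_zero_le hd y).trans ?_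
    rw [if_pos hy, if_neg hy.ne_zero, add_zero]
  have h2 : fret d 2 (0 : Site d) ≤ (1 - 1 / (d : ℝ)) * (3 / (d : ℝ) ^ 3) :=
    fret_succ_zero_le hd 1 fun y hy => fret_one_le_of_isS2 hd hy
  have h3 : fret d 3 (0 : Site d) ≤ (1 - 1 / (d : ℝ)) * (13 / (d : ℝ) ^ 4) :=
    fret_succ_zero_le hd 2 fun y hy => fret_two_le_of_isS2 hd hy
  simp only [Finset.sum_range_succ, Finset.sum_range_zero, zero_add, retHead]
  have e1 : (1 - 1 / (d : ℝ)) * (1 / (d : ℝ) ^ 2) = (1 - 1 / (d : ℝ)) / (d : ℝ) ^ 2 := by ring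
  have e2 : (1 - 1 / (d : ℝ)) * (3 / (d : ℝ) ^ 3) = 3 * (1 - 1 / (d : ℝ)) / (d : ℝ) ^ 3 := by ring
  have e3 : (1 - 1 / (d : ℝ)) * (13 / (d : ℝ) ^ 4) = 13 * (1 - 1 / (d : ℝ)) / (d : ℝ) ^ 4 := by ring
  linarith

/-- For `k ≥ 4`, `fret d k 0 ≤ P_0(D_{k+1} = 0) ≤` the factorial / balanced bounds of
`OrientedWalkCounts.lean`. [cite: BockEtAl2020, §4 (4.8)–(4.9)] -/
theorem fret_le_diffProb (k : ℕ) : fret d k (0 : Site d) ≤ diffProb d (k + 1) 0 :=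
  (fret_le k 0).trans_eq (iterAvg_ind0_zero (k + 1))

/-- `Σ_{m ∈ [d+1, N)} P_0(D_m = 0) ≤ d Σ_{j=1}^{N} balancedTerm d j` (blocks of `d` indices).
[cite: BockEtAl2020, §4 (4.9)] -/
theorem sum_diffProb_tail_le (hd : 1 ≤ d) (N : ℕ) :
    ∑ m ∈ Ico (d + 1) N, diffProb d m (0 : Site d) ≤ d * ∑ j ∈ Icc 1 N, balancedTerm d j := by
  have hd0 : (0 : ℝ) < d := by exact_mod_cast hd
  have hmaps : ∀ m ∈ Ico (d + 1) N, (m - 1) / d ∈ Icc 1 N := by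
    intro m hm
    rw [Finset.mem_Ico] at hm
    rw [Finset.mem_Icc]
    exact ⟨(Nat.le_div_iff_mul_le hd).2 (by omega), (Nat.div_le_self _ _).trans (by omega)⟩
  have hterm : ∀ m ∈ Ico (d + 1) N, diffProb d m (0 : Site d) ≤ balancedTerm d ((m - 1) / d) := by
    intro m hm
    rw [Finset.mem_Ico] at hm
    have hk' : m = (m - 1) / d * d + ((m - 1) % d + 1) := by
      have := Nat.div_add_mod (m - 1) d
      rw [mul_comm] at this
      omega
    rw [balancedTerm]
    conv_lhs => rw [hk']
    exact diffProb_le_balanced hd _ _ 0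
  calc ∑ m ∈ Ico (d + 1) N, diffProb d m (0 : Site d)
      ≤ ∑ m ∈ Ico (d + 1) N, balancedTerm d ((m - 1) / d) := Finset.sum_le_sum hterm
    _ = ∑ j ∈ Icc 1 N, ∑ m ∈ (Ico (d + 1) N).filter (fun m => (m - 1) / d = j),
          balancedTerm d ((m - 1) / d) := (Finset.sum_fiberwise_of_maps_to hmaps _).symm
    _ = ∑ j ∈ Icc 1 N, (((Ico (d + 1) N).filter (fun m => (m - 1) / d = j)).card : ℝ) *
          balancedTerm d j := by
        refine Finset.sum_congr rfl fun j _ => ?_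
        rw [Finset.sum_congr rfl fun m hm => by rw [(Finset.mem_filter.1 hm).2], Finset.sum_const,
          nsmul_eq_mul]
    _ ≤ ∑ j ∈ Icc 1 N, (d : ℝ) * balancedTerm d j := by
        refine Finset.sum_le_sum fun j _ => mul_le_mul_of_nonneg_right ?_ (balancedTerm_nonneg d j)
        have hsub : (Ico (d + 1) N).filter (fun m => (m - 1) / d = j) ⊆ Icc (j * d + 1) (j * d + d) := by
          intro m hm
          rw [Finset.mem_filter, Finset.mem_Ico] at hm
          rw [Finset.mem_Icc]
          have h1 := Nat.div_add_mod (m - 1) d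
          have h2 := Nat.mod_lt (m - 1) (show 0 < d from hd)
          rw [hm.2] at h1
          constructor
          · have : j * d ≤ m - 1 := by rw [mul_comm]; omega
            omega
          · have : m - 1 < j * d + d := by rw [mul_comm]; omega
            omega
        calc (((Ico (d + 1) N).filter (fun m => (m - 1) / d = j)).card : ℝ)
            ≤ ((Icc (j * d + 1) (j * d + d)).card : ℝ) := by exact_mod_cast Finset.card_le_card hsub
          _ = d := by
              have : j * d + d + 1 - (j * d + 1) = d := by omega
              rw [Nat.card_Icc, this]
    _ = d * ∑ j ∈ Icc 1 N, balancedTerm d j := by rw [Finset.mul_sum]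

/-- **BDNS Lemma 4.1, item 2 (finite form): `p_d ≤ B(d)`**, i.e. for every `n`,
`P_0(τ ≤ n) ≤ retHead d + retMid d + d Σ_{j=1}^{n+1} balancedTerm d j`.
[cite: BockEtAl2020, §4 Lemma 4.1 (item 2)] -/
theorem retProb_zero_le (hd : 1 ≤ d) (n : ℕ) :
    retProb d n (0 : Site d) ≤ retHead d + retMid d + d * ∑ j ∈ Icc 1 (n + 1), balancedTerm d j := by
  have hd0 : (0 : ℝ) < d := by exact_mod_cast hd
  have hnn : ∀ k, 0 ≤ fret d k (0 : Site d) := fun k => fret_nonneg k 0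
  -- split the range
  have hsplit : range n ⊆ range 4 ∪ Ico 4 n := by
    intro k hk
    rw [Finset.mem_range] at hk
    simp only [Finset.mem_union, Finset.mem_range, Finset.mem_Ico]
    omega
  -- the part `k ≥ 4` in terms of `diffProb m 0`, `m = k + 1 ≥ 5`
  have htail : ∑ k ∈ Ico 4 n, fret d k (0 : Site d) ≤ retMid d + d * ∑ j ∈ Icc 1 (n + 1), balancedTerm d j := by
    calc ∑ k ∈ Ico 4 n, fret d k (0 : Site d) ≤ ∑ k ∈ Ico 4 n, diffProb d (k + 1) 0 :=
          Finset.sum_le_sum fun k _ => fret_le_diffProb k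
      _ = ∑ m ∈ Ico 5 (n + 1), diffProb d m 0 := by
          have hI : Ico 5 (n + 1) = (Ico 4 n).map (addRightEmbedding 1) := by
            rw [Finset.map_add_right_Ico]
          rw [hI, Finset.sum_map]
          rfl
      _ ≤ ∑ m ∈ Ico 5 (d + 1) ∪ Ico (d + 1) (n + 1), diffProb d m 0 := by
          refine Finset.sum_le_sum_of_subset_of_nonneg (fun m hm => ?_) fun m _ _ => diffProb_nonneg _ _ _
          rw [Finset.mem_Ico] at hm
          simp only [Finset.mem_union, Finset.mem_Ico]
          omega
      _ ≤ ∑ m ∈ Ico 5 (d + 1), diffProb d m 0 + ∑ m ∈ Ico (d + 1) (n + 1), diffProb d m 0 :=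
          sum_union_le_of_nonneg fun m => diffProb_nonneg _ _ _
      _ ≤ retMid d + d * ∑ j ∈ Icc 1 (n + 1), balancedTerm d j := by
          refine add_le_add ?_ (sum_diffProb_tail_le hd (n + 1))
          unfold retMid
          exact Finset.sum_le_sum fun m _ => diffProb_le_factorial_div d m 0
  calc retProb d n 0 = ∑ k ∈ range n, fret d k (0 : Site d) := rfl
    _ ≤ ∑ k ∈ range 4 ∪ Ico 4 n, fret d k 0 :=
        Finset.sum_le_sum_of_subset_of_nonneg hsplit fun k _ _ => hnn k
    _ ≤ ∑ k ∈ range 4, fret d k 0 + ∑ k ∈ Ico 4 n, fret d k 0 := sum_union_le_of_nonneg hnn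
    _ ≤ retHead d + (retMid d + d * ∑ j ∈ Icc 1 (n + 1), balancedTerm d j) :=
        add_le_add (sum_fret_head_le hd) htail
    _ = _ := by ring

end Literature.Probability.Percolation

end
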